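import Mathlib

/-!
# Cauchy-characteristic slicing (LieExponent.md §3.20, Lemma 3.20 and Theorem 8)

Solo-blind seat (MatrixMultiplication).  For a functional `μ ≠ 0` on a Lie algebra `𝔤` put
`𝔚 = ker μ`, `ω(X, Y) = μ ⁅X, Y⁆` and `R′ = rad(ω|𝔚) = {X ∈ 𝔚 | ∀ Y ∈ 𝔚, μ ⁅X, Y⁆ = 0}`.  Lemma 3.20 of the
companion note: `R′` is a Lie subalgebra (the Cauchy characteristic of the right-invariant Pfaffian equation
`μ(dg g⁻¹) = 0`), it contains `𝔚 ∩ 𝔤^μ`, and `𝔚 ∩ 𝔤^μ` is an ideal of `{X | ad*_X μ ∈ ℝ μ}`.  Slicing a TPP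
triple of integral manifolds of `μ(dg g⁻¹) = 0` along the cosets of `A = exp R′` puts at least half of
`dim A` into every slice (isotropy: `soloLie_isotropic_finrank_bound`, already landed), and Lemma 2.1 inside
`A` then fails by one.  THEOREM 8: no real Lie group of odd dimension `d ≥ 5` and index `≥ 2` has a TPP triple
in the hyperplane format `((d−1)/2)³`; consequently `ω(GL₃(ℝ)) = ω(SL₄(ℝ)) = 9/2` (Blasiak–Cohn–Grochow–
Pratt–Umans, arXiv:2204.03826, Def. 4.1) and every real reductive group of rank `≤ 6` has Lie exponent `≥ 3`.

This file proves the algebraic core and the slice arithmetic: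
* `soloLie_cauchyChar_lie` — `R′` is closed under the bracket (Jacobi);
* `soloLie_ker_inf_stabilizer_subset_cauchyChar` — `𝔚 ∩ 𝔤^μ ⊆ R′`;
* `soloLie_lie_mem_ker_inf_stabilizer` — `𝔚 ∩ 𝔤^μ` is normalised by every `h` with `ad*_h μ = c μ`;
* `soloLie_hyperplane_format_slice_contradiction` — Theorem 8(1): slices `s_i ≥ (d−1)/2 − ρ/2 = a/2` in the
  `a`-dimensional group `A` (`d = a + 1 + ρ`) contradict Lemma 2.1 in `A`;
* `soloLie_pinned_pair_bound`, `soloLie_pinned_cap_even`, `soloLie_pinned_cap_odd` — Lemma 3.20(iii);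
* `soloLie_gl3_exponent_formats` — the format bookkeeping behind `ω(GL₃(ℝ)) = 9/2`: with `d = 9`, pairs
  `≤ 8`, and the hyperplane format `(4,4,4)` excluded, every positive-dimensional TPP format has `Σ ≤ 11`.
-/

set_option linter.dupNamespace false

namespace Summit.MatrixMultiplication.MatrixMultiplication.Theorems

section algebra

variable {K : Type*} [CommRing K] {L : Type*} [LieRing L] [LieAlgebra K L] (μ : L →ₗ[K] K)

/-- **`R′ = rad(ω_μ | ker μ)` is a Lie subalgebra** (LieExponent.md, Lemma 3.20(i)).  Membership in `R′` is
spelled out: `μ X = 0` and `μ ⁅X, Y⁆ = 0` for every `Y ∈ ker μ`. -/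
theorem soloLie_cauchyChar_lie {X X' : L}
    (hX : μ X = 0 ∧ ∀ Y : L, μ Y = 0 → μ ⁅X, Y⁆ = 0)
    (hX' : μ X' = 0 ∧ ∀ Y : L, μ Y = 0 → μ ⁅X', Y⁆ = 0) :
    μ ⁅X, X'⁆ = 0 ∧ ∀ Y : L, μ Y = 0 → μ ⁅⁅X, X'⁆, Y⁆ = 0 := by
  refine ⟨hX.2 X' hX'.1, fun Y hY => ?_⟩
  have h1 : μ ⁅X', Y⁆ = 0 := hX'.2 Y hY
  have h2 : μ ⁅X, Y⁆ = 0 := hX.2 Y hY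
  have h3 : μ ⁅X, ⁅X', Y⁆⁆ = 0 := hX.2 _ h1
  have h4 : μ ⁅X', ⁅X, Y⁆⁆ = 0 := hX'.2 _ h2
  rw [lie_lie, map_sub, h3, h4, sub_zero]

/-- `ker μ ∩ 𝔤^μ ⊆ R′`: an element of the coadjoint stabiliser (`μ ⁅Y, Z⁆ = 0` for all `Z`) lying in
`ker μ` is in the radical of `ω_μ | ker μ` (Lemma 3.20(i); gives `dim R′ ≥ dim 𝔤^μ − 1`). -/
theorem soloLie_ker_inf_stabilizer_subset_cauchyChar {Y : L} (hY : μ Y = 0)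
    (hstab : ∀ Z : L, μ ⁅Y, Z⁆ = 0) :
    μ Y = 0 ∧ ∀ Z : L, μ Z = 0 → μ ⁅Y, Z⁆ = 0 :=
  ⟨hY, fun Z _ => hstab Z⟩

/-- `ker μ ∩ 𝔤^μ` is normalised by every `h` with `ad*_h μ = c • μ` (i.e. `μ ⁅h, Z⁆ = c * μ Z` for all `Z`):
then `⁅h, Y⁆ ∈ ker μ ∩ 𝔤^μ` for `Y ∈ ker μ ∩ 𝔤^μ` (Lemma 3.20(i): `ker μ ∩ 𝔤^μ` is an ideal of
codimension ≤ 1 in `R′ ⊆ {X | ad*_X μ ∈ K μ}`, whence `ind R′ ≥ ind 𝔤 − 2`). -/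
theorem soloLie_lie_mem_ker_inf_stabilizer {h Y : L} {c : K} (hh : ∀ Z : L, μ ⁅h, Z⁆ = c * μ Z)
    (hY : μ Y = 0) (hstab : ∀ Z : L, μ ⁅Y, Z⁆ = 0) :
    μ ⁅h, Y⁆ = 0 ∧ ∀ Z : L, μ ⁅⁅h, Y⁆, Z⁆ = 0 := by
  refine ⟨by rw [hh, hY, mul_zero], fun Z => ?_⟩
  rw [lie_lie, map_sub, hh, hstab, hstab, mul_zero, sub_zero]

end algebra

section arithmetic

/-- **Theorem 8(1), slice arithmetic.**  `d = a + 1 + ρ` (`a = dim R′ ≥ 1`, `ρ = rank(ω_μ|ker μ)`), the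
three `A`-slices of a hyperplane-format triple satisfy `2 s_i + ρ + 1 ≥ d` (isotropy), injectivity in `A`
gives `s₁ + s₂ ≤ a`, and Lemma 2.1 in `A` gives `s₁ + s₂ + 1 ≤ a` once `s₃ ≥ 1`.  Contradiction. -/
theorem soloLie_hyperplane_format_slice_contradiction (d a ρ s₁ s₂ s₃ : ℕ) (hd : d = a + 1 + ρ)
    (ha : 1 ≤ a) (h1 : d ≤ 2 * s₁ + ρ + 1) (h2 : d ≤ 2 * s₂ + ρ + 1) (h3 : d ≤ 2 * s₃ + ρ + 1)
    (hinj : s₁ + s₂ ≤ a) (h21 : 1 ≤ s₃ → s₁ + s₂ + 1 ≤ a) : False := by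
  omega

/-- **Pinned pair bound** (Lemma 3.20(iii)): for a TPP triple pinned by `μ` with dimensions `d₁, d₂, d₃`,
slices `2 s_i + ρ ≥ 2 d_i`, `d = a + 1 + ρ`, and Lemma 2.1 in `A` (`s₃ ≥ 1 → s₁ + s₂ + 1 ≤ a`):
if `2 d₃ + a ≥ d + 1` then `d₁ + d₂ + 2 ≤ d`. -/
theorem soloLie_pinned_pair_bound (d a ρ d₁ d₂ d₃ s₁ s₂ s₃ : ℕ) (hd : d = a + 1 + ρ)
    (h1 : 2 * d₁ ≤ 2 * s₁ + ρ) (h2 : 2 * d₂ ≤ 2 * s₂ + ρ) (h3 : 2 * d₃ ≤ 2 * s₃ + ρ)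
    (hthird : d + 1 ≤ 2 * d₃ + a) (h21 : 1 ≤ s₃ → s₁ + s₂ + 1 ≤ a) : d₁ + d₂ + 2 ≤ d := by
  omega

/-- **Pinned cap, `a` odd (even `d`)**: with all three slices positive-dimensional, Lemma 2.1 in `A`
(`Σ s ≤ ⌊3(a − 1)/2⌋`, i.e. `2 Σ s + 3 ≤ 3 a` for odd `a`) and `d = a + 1 + ρ` give `2 Σ d_i + 6 ≤ 3 d`. -/
theorem soloLie_pinned_cap_even (d a ρ d₁ d₂ d₃ s₁ s₂ s₃ : ℕ) (hd : d = a + 1 + ρ)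
    (h1 : 2 * d₁ ≤ 2 * s₁ + ρ) (h2 : 2 * d₂ ≤ 2 * s₂ + ρ) (h3 : 2 * d₃ ≤ 2 * s₃ + ρ)
    (h21 : 2 * (s₁ + s₂ + s₃) + 3 ≤ 3 * a) : 2 * (d₁ + d₂ + d₃) + 6 ≤ 3 * d := by
  omega

/-- **Pinned cap, `a` even (odd `d`)**: Lemma 2.1 in `A` reads `2 Σ s + 4 ≤ 3 a` for even `a`, giving
`2 Σ d_i + 7 ≤ 3 d`. -/
theorem soloLie_pinned_cap_odd (d a ρ d₁ d₂ d₃ s₁ s₂ s₃ : ℕ) (hd : d = a + 1 + ρ)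
    (h1 : 2 * d₁ ≤ 2 * s₁ + ρ) (h2 : 2 * d₂ ≤ 2 * s₂ + ρ) (h3 : 2 * d₃ ≤ 2 * s₃ + ρ)
    (h21 : 2 * (s₁ + s₂ + s₃) + 4 ≤ 3 * a) : 2 * (d₁ + d₂ + d₃) + 7 ≤ 3 * d := by
  omega

/-- **Format bookkeeping for `ω(GL₃(ℝ)) = 9/2`** (Corollary 8.1): in dimension `d = 9`, a TPP triple of
positive-dimensional submanifolds has pairwise sums `≤ 8` (Lemma 2.1); if it is not the hyperplane format
`(4,4,4)` (excluded by Theorem 8(1)) then `Σ ≤ 11`, so it certifies at best `3/(11/3 − 3) = 9/2`. -/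
theorem soloLie_gl3_exponent_formats (d₁ d₂ d₃ : ℕ) (h12 : d₁ + d₂ ≤ 8) (h13 : d₁ + d₃ ≤ 8)
    (h23 : d₂ + d₃ ≤ 8) (hnot : ¬ (d₁ = 4 ∧ d₂ = 4 ∧ d₃ = 4)) : d₁ + d₂ + d₃ ≤ 11 := by
  omega

/-- The same for `SL₄(ℝ)` (`d = 15`): pairs `≤ 14` and not `(7,7,7)` force `Σ ≤ 20`, certifying at best
`3/(20/3 − 6) = 9/2`. -/
theorem soloLie_sl4_exponent_formats (d₁ d₂ d₃ : ℕ) (h12 : d₁ + d₂ ≤ 14) (h13 : d₁ + d₃ ≤ 14)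
    (h23 : d₂ + d₃ ≤ 14) (hnot : ¬ (d₁ = 7 ∧ d₂ = 7 ∧ d₃ = 7)) : d₁ + d₂ + d₃ ≤ 20 := by
  omega

end arithmetic

end Summit.MatrixMultiplication.MatrixMultiplication.Theorems
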